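/-
HONEST FRAMING (page 1): per-curve certified theorems and census instruments; no claim on BSD in
rank ≥ 2.

# Rank-2 observatory, rank-3 arm — Frobenius certificates for `E[p]` irreducible (KCI row 56)

Zero-kit, zero-data filing.  For a row `r` of the certified rank-3 table (`rank3Table`, 9 487 curves
of conductor `< 500 000`) and a prime `p`, a FROBENIUS CERTIFICATE is a prime `ℓ ∤ Δ(r)`, `ℓ ≠ p`,
such that `X² − a_ℓ(r)X + ℓ` has no root mod `p`.  A reducible `E[p]` has a rational character in its
semisimplification, so `a_ℓ ≡ χ₁(Frob_ℓ) + χ₂(Frob_ℓ) (mod p)` would be a root (Mazur 1978 §6; PROVED in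
the tree: `Mazur1978.hasIrreducibleModPGaloisRep_of_frobeniusTraceAt_noroot`); hence a certificate
proves `r.curve.HasIrreducibleModPGaloisRep p` WITH NO HYPOTHESIS.
The kernel (one pass over the table, `decide +kernel`, no `native_decide`) computes
`a_ℓ(r) = ℓ − Σ_x(column count)` at the witness primes `ℓ ∈ {3,…,31}` by Euler's criterion on
`(a₁x+a₃)² + 4(x³+a₂x²+a₄x+a₆)` — proved equal to the tree's `frobeniusTrace r.curve ℓ` (§2) — and
sieves Mazur's twelve primes `{2,3,5,7,11,13,17,19,37,43,67,163}` (`mazurPrimes`): `p` is certified at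
the first good `ℓ ≠ p` with `a_ℓ² − 4ℓ` a non-residue mod `p` (odd `p`) resp. `a_ℓ` odd (`p = 2`).
CENSUS: §4 certifies the packed per-chunk census of chunks `01 … 13` (rows `1 … 4576`); the sequel
file adds chunks `14 … 27` and the table totals (`1483, 225, 71, 38, 24, 45, 24, 41, 37, 55, 41, 144`
rows left uncertified at `p = 2, …, 163`; `7371` rows certified at all twelve primes, `8803` at the
eleven odd ones).  CONSEQUENCES (§3): irreducible mod `p` outright on a certified `(r, p)`; irreducible
at EVERY prime on a fully certified row granting only Mazur's Thm 1 (`mazur_isogeny_irreducible`, by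
name); SURJECTIVE mod `p` on a semistable certified `(r, p)` (row 53's
`surjective_iff_irreducible_of_semistableB`, Serre 1972 §5.4) — so `ρ̄_{5077a,p}` is onto at the twelve
primes row 53 left open, hypothesis-free, and at every prime granting Mazur (§5).  An uncertified
`(r, p)` asserts nothing (at `p = 3` they include the table's rational 3-isogenies, at `p = 2` every row
with a rational 2-torsion point).
References: B. Mazur, *Rational isogenies of prime degree*, Invent. Math. 44 (1978), §6; J.-P. Serre,
*Propriétés galoisiennes des points d'ordre fini des courbes elliptiques*, Invent. Math. 15 (1972),
§5.4–5.5; J. H. Silverman, *The Arithmetic of Elliptic Curves*, GTM 106 (2009), V.2, VII.5.1; K. Ireland, M. Rosen,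
*A Classical Introduction to Modern Number Theory*, GTM 84 (1990), Prop. 5.1.2.
-/
import Summits.BirchSwinnertonDyer.BirchSwinnertonDyer.Theorems.Rank2ObservatoryRank3GaloisImage
import Summits.BirchSwinnertonDyer.Rank1Residual.Additive.PointCountEulerNat
import Literature.NumberTheory.EllipticCurves.OpenImageMazurFrobeniusNumberFieldProofs
import Literature.NumberTheory.EllipticCurves.IsogenyFrobeniusTraceProofs
import Literature.NumberTheory.EllipticCurves.PointCountEulerCriterion
import Literature.NumberTheory.EllipticCurves.OrdinaryPrimesProofs
import HarnessLib

set_option linter.dupNamespace false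
set_option autoImplicit false

open Literature Literature.NumberTheory.EllipticCurves WeierstrassCurve
open scoped NumberField

namespace Summit.BirchSwinnertonDyer.BirchSwinnertonDyer.Rank2Observatory

/-! ## §1 The kernel evaluator (ℕ-arithmetic only) -/

/-- Least non-negative residue of `z` mod `m`, as a natural number. [folklore] -/
def resN (z : ℤ) (m : ℕ) : ℕ := (z % (m : ℤ)).toNat

/-- The column discriminant `(A₁x + A₃)² + 4(x³ + A₂x² + A₄x + A₆)` over `ℕ` (Horner form).
[folklore] -/
def colDisc (A₁ A₂ A₃ A₄ A₆ x : ℕ) : ℕ :=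
  (A₁ * x + A₃) * (A₁ * x + A₃) + 4 * (((x + A₂) * x + A₄) * x + A₆)

/-- Points over the column: `1 + χ_ℓ(d)` by Euler's criterion, `h = ℓ / 2` (Ireland–Rosen 5.1.2). [folklore] -/
def colCount (ℓ h d : ℕ) : ℕ :=
  if d % ℓ = 0 then 1 else if (d % ℓ) ^ h % ℓ = 1 then 2 else 0

/-- `#{(x, y) mod ℓ on the curve}` as a column sum (`ℓ` an odd prime). [folklore] -/
def eulerCount (ℓ A₁ A₂ A₃ A₄ A₆ : ℕ) : ℕ :=
  ((List.range ℓ).map fun x => colCount ℓ (ℓ / 2) (colDisc A₁ A₂ A₃ A₄ A₆ x)).sum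

/-- The kernel's `a_ℓ(r) = ℓ + 1 − #Ẽ_r(𝔽_ℓ) = ℓ − eulerCount` (good odd `ℓ`; = `frobeniusTrace`, §2). [folklore] -/
def Rank3Row.apInt (r : Rank3Row) (ℓ : ℕ) : ℤ :=
  (ℓ : ℤ) - (eulerCount ℓ (resN r.a₁ ℓ) (resN r.a₂ ℓ) (resN r.a₃ ℓ) (resN r.a₄ ℓ) (resN r.a₆ ℓ) : ℤ)

/-- Boolean test "`X² − aX + ℓ` has no root mod `p`": for odd `p`, `δ = a² − 4ℓ` is a quadratic
non-residue (Euler's criterion `δ^((p−1)/2) ≡ −1`); for `p = 2`, `a` and `ℓ` are odd. [folklore] -/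
def norootB (a : ℤ) (ℓ p : ℕ) : Bool :=
  if p = 2 then a % 2 == 1 && ℓ % 2 == 1 else resN (a * a - 4 * ℓ) p ^ (p / 2) % p == p - 1

/-- The witness primes searched, in this order. [folklore] -/
def witnessPrimes : List ℕ := [3, 5, 7, 11, 13, 17, 19, 23, 29, 31]

/-- Mazur's twelve primes as a list (`= mazurPrimes` as a finset, `mazurList_toFinset`). [folklore] -/
def mazurList : List ℕ := [2, 3, 5, 7, 11, 13, 17, 19, 37, 43, 67, 163]

/-- One sieve step at the witness prime `ℓ`: if some prime is still pending (`2` only drives the search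
while `ℓ ≤ 13`) and `ℓ ∤ Δ(r)`, compute `a_ℓ(r)` once and drop every pending `p ≠ ℓ` passing `norootB`. -/
def Rank3Row.sieveStep (r : Rank3Row) (pending : List ℕ) (ℓ : ℕ) : List ℕ :=
  if !(pending.any fun p => p != 2 || ℓ ≤ 13) || r.delta % (ℓ : ℤ) == 0 then pending
  else
    let a := r.apInt ℓ
    pending.filter fun p => !(ℓ != p && norootB a ℓ p)

/-- The Mazur primes left WITHOUT a Frobenius certificate after the sieve. [folklore] -/
def Rank3Row.uncertified (r : Rank3Row) : List ℕ := witnessPrimes.foldl r.sieveStep mazurList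

/-- `r` carries a Frobenius certificate at `p`. [folklore] -/
def Rank3Row.frobCertB (r : Rank3Row) (p : ℕ) : Bool :=
  mazurList.contains p && !(r.uncertified.contains p)

/-! ## §2 Soundness of the evaluator -/

/-- `resN` casts to the residue class. [folklore] -/
theorem natCast_resN (z : ℤ) (ℓ : ℕ) [NeZero ℓ] : ((resN z ℓ : ℕ) : ZMod ℓ) = (z : ZMod ℓ) := by
  have h0 : (0 : ℤ) ≤ z % (ℓ : ℤ) := Int.emod_nonneg _ (by exact_mod_cast NeZero.ne ℓ)
  have h1 : ((resN z ℓ : ℕ) : ℤ) = z % (ℓ : ℤ) := by simp [resN, Int.toNat_of_nonneg h0]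
  rw [← Int.cast_natCast, h1, ZMod.intCast_mod]
/-- `colDisc` casts to the column discriminant over `ZMod ℓ`. [folklore] -/
theorem natCast_colDisc (ℓ A₁ A₂ A₃ A₄ A₆ x : ℕ) :
    ((colDisc A₁ A₂ A₃ A₄ A₆ x : ℕ) : ZMod ℓ) =
      ((A₁ : ZMod ℓ) * x + A₃) ^ 2 + 4 * ((x : ZMod ℓ) ^ 3 + A₂ * (x : ZMod ℓ) ^ 2 + A₄ * x + A₆) := by
  simp only [colDisc]; push_cast; ring
/-- `colCount` is the Euler-criterion column count over `ZMod ℓ`. [folklore] -/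
theorem colCount_eq (ℓ : ℕ) [Fact ℓ.Prime] (d : ℕ) :
    colCount ℓ (ℓ / 2) d =
      if (d : ZMod ℓ) = 0 then 1 else if (d : ZMod ℓ) ^ (ℓ / 2) = 1 then 2 else 0 := by
  have hℓ1 : ℓ ≠ 1 := (Fact.out : ℓ.Prime).ne_one
  have h1 : (d : ZMod ℓ) = 0 ↔ d % ℓ = 0 := by
    rw [CharP.cast_eq_zero_iff (ZMod ℓ) ℓ, Nat.dvd_iff_mod_eq_zero]
  have h2 : (d : ZMod ℓ) ^ (ℓ / 2) = 1 ↔ (d % ℓ) ^ (ℓ / 2) % ℓ = 1 := by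
    rw [← ZMod.natCast_mod d ℓ, ← Nat.cast_pow, ← Nat.cast_one, ZMod.natCast_eq_natCast_iff',
      Nat.one_mod_eq_one.mpr hℓ1]
  unfold colCount
  by_cases c1 : d % ℓ = 0
  · rw [if_pos c1, if_pos (h1.mpr c1)]
  · rw [if_neg c1, if_neg (fun h => c1 (h1.mp h))]
    by_cases c2 : (d % ℓ) ^ (ℓ / 2) % ℓ = 1
    · rw [if_pos c2, if_pos (h2.mpr c2)]
    · rw [if_neg c2, if_neg (fun h => c2 (h2.mp h))]
/-- The integer Weierstrass equation of a row. [folklore] -/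
def Rank3Row.curveInt (r : Rank3Row) : WeierstrassCurve ℤ := ⟨r.a₁, r.a₂, r.a₃, r.a₄, r.a₆⟩
/-- the row's rational curve is the base change of its integer equation. [folklore] -/
theorem Rank3Row.map_curveInt (r : Rank3Row) : r.curveInt.map (Int.castRingHom ℚ) = r.curve := by
  simp [Rank3Row.curveInt, Rank3Row.curve, WeierstrassCurve.map]
/-- the integer equation has discriminant `delta`. [folklore] -/
theorem Rank3Row.curveInt_Δ (r : Rank3Row) : r.curveInt.Δ = r.delta := by
  simp only [Rank3Row.curveInt, WeierstrassCurve.Δ, WeierstrassCurve.b₂, WeierstrassCurve.b₄,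
    WeierstrassCurve.b₆, WeierstrassCurve.b₈, Rank3Row.delta]
  ring
/-- **Point count**: for an odd prime `ℓ ∤ Δ(r)`, `#Ẽ_r(𝔽_ℓ)` (affine points plus `O`) is
`1 + eulerCount` (Silverman V.2 with Euler's criterion; the tree's `card_sol_eq_sum_euler`, reindexed by
the landed `PointCountNat.sum_zmod_eq_sum_range` of the rank-1 arm). [folklore] -/
theorem Rank3Row.natCard_point_eq_eulerCount (r : Rank3Row) (ℓ : ℕ) [Fact ℓ.Prime] (hℓ2 : ℓ ≠ 2)
    (hΔ : (r.curveInt.map (Int.castRingHom (ZMod ℓ))).Δ ≠ 0) :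
    Nat.card (r.curveInt.map (Int.castRingHom (ZMod ℓ))).toAffine.Point =
      1 + eulerCount ℓ (resN r.a₁ ℓ) (resN r.a₂ ℓ) (resN r.a₃ ℓ) (resN r.a₄ ℓ) (resN r.a₆ ℓ) := by
  rw [natCard_point_eq_one_add_card _ hΔ,
    card_sol_eq_sum_euler (by rw [ZMod.ringChar_zmod_n]; exact hℓ2), ZMod.card]
  congr 1
  rw [eulerCount, ← Rank1Residual.Additive.PointCountNat.sum_range_eq_sum_map_range,
    Rank1Residual.Additive.PointCountNat.sum_zmod_eq_sum_range]
  refine Finset.sum_congr rfl fun i _ => ?_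
  rw [colCount_eq, natCast_colDisc, natCast_resN, natCast_resN, natCast_resN, natCast_resN,
    natCast_resN]
  simp only [WeierstrassCurve.map_a₁, WeierstrassCurve.map_a₂, WeierstrassCurve.map_a₃,
    WeierstrassCurve.map_a₄, WeierstrassCurve.map_a₆, Rank3Row.curveInt, eq_intCast]
/-- the tree's chosen minimal integral model of a census row IS the row's equation. [folklore] -/
theorem Rank3Row.integralModelInt_eq_curveInt {r : Rank3Row} (hr : r ∈ rank3Table) :
    haveI := Rank3Row.isGloballyMinimal_of_mem hr; integralModelInt r.curve = r.curveInt := by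
  haveI := Rank3Row.isGloballyMinimal_of_mem hr
  apply WeierstrassCurve.map_injective (f := Int.castRingHom ℚ) Int.cast_injective
  simp only [map_integralModelInt]
  exact r.map_curveInt.symm
/-- the minimal discriminant of a census row is its `delta`. [folklore] -/
theorem Rank3Row.minimalDiscriminantInt_eq_delta {r : Rank3Row} (hr : r ∈ rank3Table) :
    haveI := Rank3Row.isGloballyMinimal_of_mem hr; minimalDiscriminantInt r.curve = r.delta := by
  haveI := Rank3Row.isGloballyMinimal_of_mem hr
  have h := cast_minimalDiscriminantInt r.curve
  rw [Rank3Row.curve_Δ] at h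
  exact_mod_cast h
/-- **Good reduction at `ℓ ∤ Δ(r)`** (the row's equation is globally minimal: rows 10–14;
Silverman VII.5.1 (a), the tree's `hasGoodReductionAtPrime_of_not_dvd`). [folklore] -/
theorem Rank3Row.hasGoodReductionAtPrime_of_not_dvd {r : Rank3Row} (hr : r ∈ rank3Table) (ℓ : ℕ)
    [Fact ℓ.Prime] (h : ¬ ((ℓ : ℤ) ∣ r.delta)) : r.curve.HasGoodReductionAtPrime ℓ := by
  haveI := Rank3Row.isGloballyMinimal_of_mem hr
  exact WeierstrassCurve.hasGoodReductionAtPrime_of_not_dvd _ ℓ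
    (by rwa [Rank3Row.minimalDiscriminantInt_eq_delta hr])
/-- **The kernel's `a_ℓ` is the trace of Frobenius**: `frobeniusTrace r.curve ℓ = r.apInt ℓ` for an
odd prime `ℓ ∤ Δ(r)` (Silverman V.2). [folklore] -/
theorem Rank3Row.frobeniusTrace_eq_apInt {r : Rank3Row} (hr : r ∈ rank3Table) (ℓ : ℕ) [Fact ℓ.Prime]
    (hℓ2 : ℓ ≠ 2) (h : ¬ ((ℓ : ℤ) ∣ r.delta)) :
    haveI := Rank3Row.isGloballyMinimal_of_mem hr; frobeniusTrace r.curve ℓ = r.apInt ℓ := by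
  haveI := Rank3Row.isGloballyMinimal_of_mem hr
  have hΔ : (r.curveInt.map (Int.castRingHom (ZMod ℓ))).Δ ≠ 0 := by
    rw [WeierstrassCurve.map_Δ, Rank3Row.curveInt_Δ, eq_intCast, ne_eq,
      ZMod.intCast_zmod_eq_zero_iff_dvd]
    exact h
  rw [frobeniusTrace, reductionPointCount, Rank3Row.integralModelInt_eq_curveInt hr,
    r.natCard_point_eq_eulerCount ℓ hℓ2 hΔ, Rank3Row.apInt]
  push_cast
  ring
/-- **Mazur's Frobenius criterion over `ℚ` at a rational prime** (the tree's number-field form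
`Mazur1978.hasIrreducibleModPGaloisRep_of_frobeniusTraceAt_noroot` at the place `v ↔ ℓ`):
if `ℓ ≠ p` is a prime of good reduction and `X² − a_ℓ X + ℓ` has no root mod `p`, then `E[p]` is
irreducible. [cite: Mazur1978, §6] -/
theorem hasIrreducibleModPGaloisRep_of_frobeniusTrace_noroot (W : WeierstrassCurve ℚ)
    [W.IsElliptic] [W.IsGloballyMinimal] (p ℓ : ℕ) [Fact p.Prime] [Fact ℓ.Prime] (hℓp : ℓ ≠ p)
    (hgood : W.HasGoodReductionAtPrime ℓ)
    (hnoroot : ∀ t : ZMod p, t ^ 2 - (W.frobeniusTrace ℓ : ZMod p) * t + (ℓ : ZMod p) ≠ 0) :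
    W.HasIrreducibleModPGaloisRep p := by
  set v := (Rat.HeightOneSpectrum.primesEquiv (R := 𝓞 ℚ)).symm ⟨ℓ, Fact.out⟩ with hv
  have hvℓ : (Rat.HeightOneSpectrum.primesEquiv v : ℕ) = ℓ := by
    rw [hv, Equiv.apply_symm_apply]
  refine Mazur1978.hasIrreducibleModPGaloisRep_of_frobeniusTraceAt_noroot W p
    ((hasGoodReductionAtPrime_primesEquiv_iff_holds W v ℓ hvℓ).mp hgood)
    (natCast_not_mem_asIdeal_of_primesEquiv_ne Fact.out (hvℓ ▸ hℓp)) ?_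
  rw [frobeniusTraceAt_eq_frobeniusTrace, natCard_residueField_adicCompletionIntegers, hvℓ]
  exact hnoroot

/-- `X² + X + 1` has no root mod `2`. [folklore] -/
theorem zmod2_noroot : ∀ u : ZMod 2, u ^ 2 - 1 * u + 1 ≠ 0 := by decide

/-- Soundness of `norootB`. [folklore] -/
theorem noroot_of_norootB (a : ℤ) (ℓ p : ℕ) [Fact p.Prime] (h : norootB a ℓ p = true) :
    ∀ t : ZMod p, t ^ 2 - (a : ZMod p) * t + (ℓ : ZMod p) ≠ 0 := by
  intro t ht
  by_cases hp2 : p = 2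
  · subst hp2
    simp only [norootB, if_true, Bool.and_eq_true, beq_iff_eq] at h
    have ha : (a : ZMod 2) = 1 := by
      rw [← ZMod.intCast_mod a 2]; norm_num [h.1]
    have hl : (ℓ : ZMod 2) = 1 := by
      rw [← ZMod.natCast_mod ℓ 2, h.2, Nat.cast_one]
    rw [ha, hl] at ht
    exact zmod2_noroot t ht
  · have hp : p.Prime := Fact.out
    haveI : Fact (2 < p) := ⟨lt_of_le_of_ne hp.two_le (Ne.symm hp2)⟩
    haveI : NeZero p := ⟨hp.ne_zero⟩
    simp only [norootB, if_neg hp2, beq_iff_eq] at h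
    have hcast : ((resN (a * a - 4 * ℓ) p : ℕ) : ZMod p) = (a : ZMod p) ^ 2 - 4 * (ℓ : ZMod p) := by
      rw [natCast_resN]; push_cast; ring
    have hm1 : ((a : ZMod p) ^ 2 - 4 * (ℓ : ZMod p)) ^ (p / 2) = -1 := by
      rw [← hcast, ← Nat.cast_pow, ← ZMod.natCast_mod (resN (a * a - 4 * ℓ) p ^ (p / 2)) p, h,
        Nat.cast_sub hp.one_le, Nat.cast_one, ZMod.natCast_self, zero_sub]
    have hne : (a : ZMod p) ^ 2 - 4 * (ℓ : ZMod p) ≠ 0 := by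
      intro h0
      rw [h0, zero_pow (Nat.div_pos hp.two_le two_pos).ne'] at hm1
      exact one_ne_zero (neg_eq_zero.mp hm1.symm)
    have hsq : IsSquare ((a : ZMod p) ^ 2 - 4 * (ℓ : ZMod p)) :=
      ⟨2 * t - a, by linear_combination (-4 : ZMod p) * ht⟩
    have h1 := (ZMod.euler_criterion p hne).mp hsq
    rw [hm1] at h1
    exact ZMod.neg_one_ne_one h1

/-! ## §3 From a certificate to the Galois image -/

/-- the witness primes are odd primes (kernel). [folklore] -/
theorem witnessPrimes_prime : ∀ ℓ ∈ witnessPrimes, ℓ.Prime ∧ ℓ ≠ 2 := by decide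

/-- Invariant of the sieve: a Mazur prime absent from the output was dropped at a good witness prime
`ℓ ≠ p` where `norootB (a_ℓ) ℓ p` holds. [folklore] -/
theorem Rank3Row.exists_witness_of_not_mem_foldl (r : Rank3Row) (p : ℕ) :
    ∀ (L pending : List ℕ), p ∈ pending → p ∉ L.foldl r.sieveStep pending →
      ∃ ℓ ∈ L, ℓ ≠ p ∧ ¬ ((ℓ : ℤ) ∣ r.delta) ∧ norootB (r.apInt ℓ) ℓ p = true := by
  intro L
  induction L with
  | nil => intro pending hp hn; exact absurd hp hn
  | cons ℓ L ih =>
    intro pending hp hn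
    rw [List.foldl_cons] at hn
    by_cases hstep : p ∈ r.sieveStep pending ℓ
    · obtain ⟨ℓ', hℓ', h⟩ := ih _ hstep hn
      exact ⟨ℓ', List.mem_cons_of_mem _ hℓ', h⟩
    · refine ⟨ℓ, List.mem_cons_self, ?_⟩
      unfold Rank3Row.sieveStep at hstep
      split_ifs at hstep with hc
      · exact absurd hp hstep
      · rw [List.mem_filter, not_and, Bool.not_eq_true', Bool.not_eq_false, Bool.and_eq_true,
          bne_iff_ne] at hstep
        obtain ⟨hne, hnr⟩ := hstep hp
        refine ⟨hne, ?_, hnr⟩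
        rw [Int.dvd_iff_emod_eq_zero]
        intro h0; exact hc (by simp [h0])

/-- **A Frobenius certificate proves `E[p]` irreducible — hypothesis-free.** [cite: Mazur1978, §6] -/
theorem Rank3Row.hasIrreducibleModPGaloisRep_of_frobCertB {r : Rank3Row} (hr : r ∈ rank3Table)
    (p : ℕ) [Fact p.Prime] (h : r.frobCertB p = true) : r.curve.HasIrreducibleModPGaloisRep p := by
  haveI := isElliptic_of_mem hr
  haveI := Rank3Row.isGloballyMinimal_of_mem hr
  simp only [Rank3Row.frobCertB, Bool.and_eq_true, Bool.not_eq_true', ← Bool.not_eq_true,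
    List.contains_iff_mem] at h
  obtain ⟨hpM, hpU⟩ := h
  obtain ⟨ℓ, hℓ, hℓp, hgood, hnr⟩ := r.exists_witness_of_not_mem_foldl p witnessPrimes mazurList
    (by simpa using hpM) (by simpa [Rank3Row.uncertified] using hpU)
  haveI : Fact ℓ.Prime := ⟨(witnessPrimes_prime ℓ hℓ).1⟩
  refine hasIrreducibleModPGaloisRep_of_frobeniusTrace_noroot r.curve p ℓ hℓp
    (Rank3Row.hasGoodReductionAtPrime_of_not_dvd hr ℓ hgood) ?_
  rw [Rank3Row.frobeniusTrace_eq_apInt hr ℓ (witnessPrimes_prime ℓ hℓ).2 hgood]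
  exact noroot_of_norootB _ ℓ p hnr

/-- `mazurList` enumerates `mazurPrimes`. [folklore] -/
theorem mazurList_toFinset : mazurList.toFinset = mazurPrimes := by decide
/-- a fully certified row carries a certificate at each of Mazur's primes. [folklore] -/
theorem Rank3Row.frobCertB_of_uncertified_eq_nil {r : Rank3Row} (h : r.uncertified = []) {p : ℕ}
    (hp : p ∈ mazurPrimes) : r.frobCertB p = true := by
  rw [← mazurList_toFinset, List.mem_toFinset] at hp
  simp [Rank3Row.frobCertB, h, hp]

/-- **Irreducible at every prime** on a row certified at all twelve of Mazur's primes, granting Mazur's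
isogeny theorem for the others (`mazur_isogeny_irreducible`, cited by name). [cite: Mazur1978, Thm 1] -/
theorem Rank3Row.hasIrreducibleModPGaloisRep_forall {r : Rank3Row} (hr : r ∈ rank3Table)
    (hM : mazur_isogeny_irreducible) (h : r.uncertified = []) (p : ℕ) (hp : p.Prime) :
    r.curve.HasIrreducibleModPGaloisRep p := by
  haveI := isElliptic_of_mem hr
  haveI : Fact p.Prime := ⟨hp⟩
  by_cases hpM : p ∈ mazurPrimes
  · exact Rank3Row.hasIrreducibleModPGaloisRep_of_frobCertB hr p
      (Rank3Row.frobCertB_of_uncertified_eq_nil h hpM)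
  · exact hM r.curve p hp hpM

/-- **Surjective mod `p`** on a semistable row with a certificate at `p` (row 53: for semistable
curves surjective ⇔ irreducible, Serre 1972 §5.4 Prop. 21 + Cor. of §3). Hypothesis-free.
[cite: Serre1972, §5.4] -/
theorem Rank3Row.hasSurjectiveModNGaloisRep_of_frobCertB {r : Rank3Row} (hr : r ∈ rank3Table)
    (hs : r.semistableB = true) (p : ℕ) [Fact p.Prime] (h : r.frobCertB p = true) :
    r.curve.HasSurjectiveModNGaloisRep p :=
  (surjective_iff_irreducible_of_semistableB hr hs p).mpr
    (Rank3Row.hasIrreducibleModPGaloisRep_of_frobCertB hr p h)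

/-! ## §4 The census, part I (chunks `01 … 13`; one kernel pass per chunk) -/
/-- The row's one-hot census increment: sixteen `0/1` digits packed in base `2¹⁶` (digit `i < 12`:
the `i`-th Mazur prime is left uncertified; 12: all twelve certified; 13: the eleven odd ones; 14, 15:
the same two and the row is semistable, `semistableB` of row 50). [folklore] -/
def Rank3Row.frobCensusInc (r : Rank3Row) : ℕ :=
  let u := r.uncertified; let ss : Bool := r.semistableB
  Nat.ofDigits 65536 ((mazurList.map fun p => if u.contains p then 1 else 0) ++
    [if u.isEmpty then 1 else 0, if u.all (· == 2) then 1 else 0,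
      if ss && u.isEmpty then 1 else 0, if ss && u.all (· == 2) then 1 else 0])

/-- Strict left fold of the increments (the `match` forces the accumulator at every row). [folklore] -/
def frobCensusGo : List Rank3Row → ℕ → ℕ
  | [], acc => acc
  | r :: rs, acc =>
    match acc + r.frobCensusInc with
    | 0 => frobCensusGo rs 0
    | n + 1 => frobCensusGo rs (n + 1)

/-- the strict fold computes the sum of the increments. [folklore] -/
theorem frobCensusGo_eq (rows : List Rank3Row) (acc : ℕ) :
    frobCensusGo rows acc = acc + (rows.map Rank3Row.frobCensusInc).sum := by
  induction rows generalizing acc with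
  | nil => simp [frobCensusGo]
  | cons r rs ih =>
    rw [frobCensusGo, List.map_cons, List.sum_cons, ← Nat.add_assoc]
    split <;> rename_i h <;> rw [ih, h]

section censusI
set_option maxHeartbeats 1000000
/-! **KCI row 56 — the census, part I**: the packed census value of each chunk `rank3Rows01 … 13` (rows
`1 … 4576`), one kernel pass each; chunks `14 … 27`, the table total and its exact decoding (`1483, 225,
71, 38, 24, 45, 24, 41, 37, 55, 41, 144` rows uncertified at `p = 2, …, 163`; `7371` / `8803`) follow. -/
/-- chunk `01` (rows `1 … 352`). [folklore] -/ theorem frobCensus01 : frobCensusGo rank3Rows01 0 = 358675049716922285566835142858620871584526184873736908367021839424982220827 := by decide +kernel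
/-- chunk `02` (rows `353 … 704`). [folklore] -/ theorem frobCensus02 : frobCensusGo rank3Rows02 0 = 330404903562464104547549563562492695304078806766172093679210523118943666222 := by decide +kernel
/-- chunk `03` (rows `705 … 1056`). [folklore] -/ theorem frobCensus03 : frobCensusGo rank3Rows03 0 = 303901847108190626145140116496872120849831873126135026375946037524923809837 := by decide +kernel
/-- chunk `04` (rows `1057 … 1408`). [folklore] -/ theorem frobCensus04 : frobCensusGo rank3Rows04 0 = 319803767252254959711353203672047561285397827962177081354577737548204081194 := by decide +kernel
/-- chunk `05` (rows `1409 … 1760`). [folklore] -/ theorem frobCensus05 : frobCensusGo rank3Rows05 0 = 312735839792973825420390067083147603991692165808094930678283478764945539131 := by decide +kernel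
/-- chunk `06` (rows `1761 … 2112`). [folklore] -/ theorem frobCensus06 : frobCensusGo rank3Rows06 0 = 333938597694900543844159776601358322982382929614015308742023970293490647087 := by decide +kernel
/-- chunk `07` (rows `2113 … 2464`). [folklore] -/ theorem frobCensus07 : frobCensusGo rank3Rows07 0 = 273865042605289746844897458639895603240963139759451788380888807533166854198 := by decide +kernel
/-- chunk `08` (rows `2465 … 2816`). [folklore] -/ theorem frobCensus08 : frobCensusGo rank3Rows08 0 = 296834351010113141117303892942254246876510540860250559592120056809303375924 := by decide +kernel
/-- chunk `09` (rows `2817 … 3168`). [folklore] -/ theorem frobCensus09 : frobCensusGo rank3Rows09 0 = 282699197052632657323465520296243532313663256705556514829522944671131369535 := by decide +kernel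
/-- chunk `10` (rows `3169 … 3520`). [folklore] -/ theorem frobCensus10 : frobCensusGo rank3Rows10 0 = 268564312695441685194684672736854626728117885114318435482476967422539006016 := by decide +kernel
/-- chunk `11` (rows `3521 … 3872`). [folklore] -/ theorem frobCensus11 : frobCensusGo rank3Rows11 0 = 296834243170326466237834542291556106164805735034286004183871890371679486003 := by decide +kernel
/-- chunk `12` (rows `3873 … 4224`). [folklore] -/ theorem frobCensus12 : frobCensusGo rank3Rows12 0 = 330404957478243633516197115431132810912587556155170969705250402700666404907 := by decide +kernel
/-- chunk `13` (rows `4225 … 4576`). [folklore] -/ theorem frobCensus13 : frobCensusGo rank3Rows13 0 = 254429050894060727465176177639482782123125234695110450517952830429069246532 := by decide +kernel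
end censusI

/-! ## §5 Row `0` by name: `5077a1 = Curve5077a.E` -/
/-- Row `0` (`5077a1`, `y² + y = x³ − 7x + 6`): the kernel's `a_3, a_5, a_7 = −3, −4, −4`. [folklore] -/
theorem row0_apInt :
    [3, 5, 7].map (rank3Table[0]'(by rw [rank3Table_length]; decide)).apInt = [-3, -4, -4] := by
  decide +kernel
/-- Row `0` is certified at all twelve of Mazur's primes (kernel). [folklore] -/
theorem row0_uncertified_eq_nil :
    (rank3Table[0]'(by rw [rank3Table_length]; decide)).uncertified = [] := by decide +kernel

/-- **`ρ̄_{5077a,p}` is surjective at each of Mazur's twelve primes — hypothesis-free** (Frobenius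
certificates + Serre's Prop. 21; row 53 left exactly these primes open). [cite: Serre1972, §5.4 Prop. 21] -/
theorem curve5077a_surjective_of_mem_mazurPrimes (p : ℕ) [Fact p.Prime] (hp : p ∈ mazurPrimes) :
    Curve5077a.E.HasSurjectiveModNGaloisRep p := by
  rw [← curve_row0_eq]
  exact Rank3Row.hasSurjectiveModNGaloisRep_of_frobCertB (List.getElem_mem _)
    rank3Table_row0_semistableB p (Rank3Row.frobCertB_of_uncertified_eq_nil row0_uncertified_eq_nil hp)

/-- **Granting Mazur's Thm. 1, `ρ̄_{5077a,p}` is surjective at EVERY prime `p`** (the twelve small primes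
by kernel certificate, the rest by row 53). [cite: Mazur1978, Thm 1] [cite: Serre1972, §5.4 Prop. 21] -/
theorem curve5077a_surjective_of_mazur (hM : mazur_isogeny_irreducible) (p : ℕ) (hp : p.Prime) :
    Curve5077a.E.HasSurjectiveModNGaloisRep p := by
  rw [← curve_row0_eq]
  haveI : Fact p.Prime := ⟨hp⟩
  exact (surjective_iff_irreducible_of_semistableB (List.getElem_mem _)
    rank3Table_row0_semistableB p).mpr
    (Rank3Row.hasIrreducibleModPGaloisRep_forall (List.getElem_mem _) hM row0_uncertified_eq_nil p hp)

end Summit.BirchSwinnertonDyer.BirchSwinnertonDyer.Rank2Observatory
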